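import Mathlib.Data.Set.Card
import Literature.ModelTheory.FiniteModelTheory.CPTCardProgram
import Literature.ModelTheory.FiniteModelTheory.CPTCardPTIMEEval
import HarnessLib

/-!
# Simulating BGS programs in polynomial time, III: the census of active objects and the run

Topic `Literature/ModelTheory/FiniteModelTheory`; third support file of the discharge of
`Literature.ModelTheory.FiniteModelTheory.CPTCardInPTIME` (Blass–Gurevich–Shelah 1999, §5.2
Theorem 1). With the guarded evaluator of `CPTCardPTIMEEval.lean` we assemble the SIMULATION of
a PTime bounded program `(Π, p, q)` on the graph with `n` vertices and adjacency bits `adj`: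

* the CENSUS (Blass–Gurevich–Shelah 1999, §5.1): `critMask` marks the indices of the critical
  objects of the current state (atoms, `0`, `1`, values and location components of the coded
  state), `closeMask` closes the marks downwards in ONE descending pass (members sit below their
  set in a canonical table), so that the marked indices are exactly those of the ACTIVE objects
  (`getD_activeMask_iff_active`); `orMask` accumulates the objects active in the run so far,
  `countTrue` counts them — injectivity of `val` makes this the cardinality of `activeSet`;
* the ROUND `round`: census of `A_k`, comparison with `q(n)`, the `Halt`/`Output` test, else one
  step `den`/`fireS`; the RUN `run` = `p(n) + 1` guarded rounds from the initial table; its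
  STATUS `1`/`2` (halted with `Output = true/false` within the bounds), `3` (too many active
  objects), `4` (halted with a non-Boolean output), `0` (no halt within `p(n)` steps);
* SOUNDNESS MODULO OVERFLOW (`run_sound`): if the overflow flag is down at the end, the status is
  `1` iff the program ACCEPTS `⟨n, graph n adj⟩` and `2` iff it REJECTS it, in the sense of
  `CPTCardProgram.Accepts/Rejects` — via the abstract first-event description `absRun` of the
  bounded run (Blass–Gurevich–Shelah 1999, §5.1: "the longest initial segment … such that the
  length is ≤ p(n) and the number of active objects is ≤ q(n)").

## References

* A. Blass, Y. Gurevich, S. Shelah, *Choiceless polynomial time*, Ann. Pure Appl. Logic 100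
  (1999) = arXiv:math/9705225, §5.1 (critical and active objects, PTime programs, acceptance),
  §5.2 Theorem 1.
-/

noncomputable section

namespace Literature.ModelTheory.FiniteModelTheory

/-! ### A transitivity property of `HF.tc` -/

namespace HF

variable {α : Type*}

/-- Members of hereditary members are hereditary members. [folklore] -/
theorem mem_tc_of_mem_of_mem_tc {x y c : HF α} (hy : y ∈ tc c) (hx : x ∈ y) : x ∈ tc c := by
  suffices h : ∀ (m : ℕ) (c : HF α), rank c ≤ m → y ∈ tc c → x ∈ tc c from h _ c le_rfl hy
  intro m
  induction m with
  | zero =>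
    intro c hc hyc
    obtain ⟨w, hw, -⟩ := mem_tc_iff.mp hyc
    have := rank_lt_of_mem hw
    omega
  | succ m ih =>
    intro c hc hyc
    obtain ⟨w, hw, h⟩ := mem_tc_iff.mp hyc
    rcases h with rfl | h
    · exact mem_tc_iff.mpr ⟨y, hw, Or.inr (mem_tc_of_mem hx)⟩
    · have hwm : rank w ≤ m := Nat.lt_succ_iff.mp ((rank_lt_of_mem hw).trans_le hc)
      exact mem_tc_iff.mpr ⟨w, hw, Or.inr (ih w hwm h)⟩

/-- The transitive closure of a hereditary member is included. [folklore] -/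
theorem tc_subset_tc_of_mem_tc {y c : HF α} (hy : y ∈ tc c) : tc y ⊆ tc c := by
  suffices h : ∀ (m : ℕ) (y : HF α), rank y ≤ m → y ∈ tc c → tc y ⊆ tc c from h _ y le_rfl hy
  intro m
  induction m with
  | zero =>
    intro y hy _ z hz
    obtain ⟨w, hw, -⟩ := mem_tc_iff.mp hz
    have := rank_lt_of_mem hw
    omega
  | succ m ih =>
    intro y hym hyc z hz
    obtain ⟨w, hw, h⟩ := mem_tc_iff.mp hz
    have hwc : w ∈ tc c := mem_tc_of_mem_of_mem_tc hyc hw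
    rcases h with rfl | h
    · exact hwc
    · exact ih w (Nat.lt_succ_iff.mp ((rank_lt_of_mem hw).trans_le hym)) hwc h

end HF

namespace BGS.Sim

open Literature.Computability.Complexity (TwoColouring.graph)

variable {n : ℕ}

/-! ### Reachability of indices and the transitive closure -/

/-- Index `i` is REACHABLE from index `c` by descending along member lists. [folklore] -/
inductive Reach (n : ℕ) (T : List (List ℕ)) : ℕ → ℕ → Prop
  /-- every index reaches itself -/
  | refl (i : ℕ) : Reach n T i i
  /-- a member of a reachable index is reachable -/
  | tail {c i k : ℕ} : Reach n T c i → k ∈ elems n T i → Reach n T c k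

/-- Reachable indices are valid (from a valid start, in a canonical table). [folklore] -/
theorem Reach.lt_length {T : List (List ℕ)} (hT : Canon n T) {c i : ℕ} (h : Reach n T c i)
    (hc : c < T.length) : i < T.length := by
  induction h with
  | refl => exact hc
  | tail _ hk ih => exact (hT.lt_of_mem_elems ih hk).trans ih

/-- **Reachability is hereditary membership**: an index reachable from `c` is `c` or denotes a
hereditary member of the object of `c`. [folklore] -/
theorem Reach.eq_or_mem_tc {T : List (List ℕ)} (hT : Canon n T) {c i : ℕ} (h : Reach n T c i)
    (hc : c < T.length) : i = c ∨ val n T i ∈ HF.tc (val n T c) := by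
  induction h with
  | refl => exact Or.inl rfl
  | tail hr hk ih =>
    have hi := hr.lt_length hT hc
    have hmem : val n T _ ∈ val n T _ := ((hT.mem_elems_iff hi _).mp hk).2
    rcases ih with rfl | ih
    · exact Or.inr (HF.mem_tc_of_mem hmem)
    · exact Or.inr (HF.mem_tc_of_mem_of_mem_tc ih hmem)

/-- Conversely every hereditary member of the object of a valid index is denoted by a reachable
index. [folklore] -/
theorem exists_reach_of_mem_tc {T : List (List ℕ)} (hT : Canon n T) :
    ∀ (c : ℕ), c < T.length → ∀ x ∈ HF.tc (val n T c), ∃ k, Reach n T c k ∧ val n T k = x := by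
  intro c
  induction c using Nat.strong_induction_on with
  | _ c ih =>
    intro hc x hx
    obtain ⟨y, hy, h⟩ := HF.mem_tc_iff.mp hx
    obtain ⟨k, hk, rfl⟩ := (hT.mem_val_iff_elems hc y).mp hy
    have hkc := hT.lt_of_mem_elems hc hk
    rcases h with rfl | h
    · exact ⟨k, (Reach.refl c).tail hk, rfl⟩
    · obtain ⟨k', hk', rfl⟩ := ih k hkc (hkc.trans hc) x h
      -- prepend the step `c → k` to the path from `k`
      have lift : ∀ {j : ℕ}, Reach n T k j → Reach n T c j := by
        intro j hj
        induction hj with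
        | refl => exact (Reach.refl c).tail hk
        | tail _ hm ihj => exact ihj.tail hm
      exact ⟨k', lift hk', rfl⟩

/-! ### Critical and active objects, on indices -/

/-- Index `c` is CRITICAL for the coded state: an atom, `0`, `1`, a stored value or a component
of a stored location. [Blass–Gurevich–Shelah 1999, §5.1] [folklore] -/
def CritIdx (n : ℕ) (srep : List CUpdate) (c : ℕ) : Prop :=
  c < n + 2 ∨ ∃ e ∈ srep, e.2 = c ∨ c ∈ e.1.2

/-- **Critical objects are the objects of critical indices.** [Blass–Gurevich–Shelah 1999, §5.1]
[folklore] -/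
theorem critical_iff {T : List (List ℕ)} {srep : List CUpdate} {Sd : DynState n} (hT : Canon n T)
    (hs : SRel n T srep Sd) (x : HF (Fin n)) :
    Sd.Critical x ↔ ∃ c < T.length, CritIdx n srep c ∧ val n T c = x := by
  have hlen := hT.le_length
  constructor
  · rintro (⟨a, rfl⟩ | ⟨b, rfl⟩ | ⟨f, args, rfl⟩ | ⟨f, args, hne, hx⟩)
    · exact ⟨a, by omega, Or.inl (by omega), val_of_lt T a.2⟩
    · exact ⟨boolIdx n b, hT.boolIdx_lt_length b, Or.inl (by cases b <;> simp [boolIdx]),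
        hT.val_boolIdx b⟩
    · by_cases h0 : Sd f args = ∅
      · exact ⟨n, by omega, Or.inl (by omega), by rw [h0, hT.val_n]⟩
      · obtain ⟨e, he, rfl, rfl⟩ := hs.complete f args h0
        exact ⟨e.2, hs.val_lt e he, Or.inr ⟨e, he, Or.inl rfl⟩, (hs.apply_eq e he).symm⟩
    · obtain ⟨e, he, rfl, rfl⟩ := hs.complete f args hne
      obtain ⟨k, hk, rfl⟩ := List.mem_map.mp hx
      exact ⟨k, hs.args_lt e he k hk, Or.inr ⟨e, he, Or.inr hk⟩, rfl⟩
  · rintro ⟨c, hc, hcrit, rfl⟩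
    rcases hcrit with hc2 | ⟨e, he, rfl | hce⟩
    · by_cases hcn : c < n
      · exact Or.inl ((isAtom_val_iff T c).mpr hcn)
      · have : c = n ∨ c = n + 1 := by omega
        rcases this with rfl | rfl
        · exact Or.inr (Or.inl ⟨false, hT.val_n⟩)
        · exact Or.inr (Or.inl ⟨true, hT.val_n_succ⟩)
    · exact Or.inr (Or.inr (Or.inl ⟨e.1.1, _, hs.apply_eq e he⟩))
    · refine Or.inr (Or.inr (Or.inr ⟨e.1.1, e.1.2.map (val n T), ?_, List.mem_map.mpr ⟨c, hce, rfl⟩⟩))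
      rw [hs.apply_eq e he, Ne, hT.val_eq_empty_iff (hs.val_lt e he)]
      exact hs.val_ne e he

/-- **Active objects are the objects of indices reachable from critical indices.**
[Blass–Gurevich–Shelah 1999, §5.1] [folklore] -/
theorem active_iff {T : List (List ℕ)} {srep : List CUpdate} {Sd : DynState n} (hT : Canon n T)
    (hs : SRel n T srep Sd) (x : HF (Fin n)) :
    Sd.Active x ↔
      ∃ i < T.length, (∃ c < T.length, CritIdx n srep c ∧ Reach n T c i) ∧ val n T i = x := by
  constructor
  · rintro ⟨y, hy, h⟩
    obtain ⟨c, hc, hcrit, rfl⟩ := (critical_iff hT hs y).mp hy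
    rcases h with rfl | h
    · exact ⟨c, hc, ⟨c, hc, hcrit, Reach.refl c⟩, rfl⟩
    · obtain ⟨k, hk, rfl⟩ := exists_reach_of_mem_tc hT c hc x h
      exact ⟨k, hk.lt_length hT hc, ⟨c, hc, hcrit, hk⟩, rfl⟩
  · rintro ⟨i, hi, ⟨c, hc, hcrit, hr⟩, rfl⟩
    refine ⟨val n T c, (critical_iff hT hs _).mpr ⟨c, hc, hcrit, rfl⟩, ?_⟩
    rcases hr.eq_or_mem_tc hT hc with rfl | h
    · exact Or.inl rfl
    · exact Or.inr h

/-! ### The census: masks -/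

/-- The mask of critical indices (length `|T|`). [Blass–Gurevich–Shelah 1999, §5.1] [folklore] -/
def critMask (n : ℕ) (T : List (List ℕ)) (srep : List CUpdate) : List Bool :=
  (List.range T.length).map fun i =>
    decide (i < n + 2) || srep.any fun e => e.2 == i || e.1.2.any (· == i)

/-- Marking a list of indices (pointwise, over the index range of the mask). [folklore] -/
def markAll (m : List Bool) (l : List ℕ) : List Bool :=
  (List.range m.length).map fun i => m.getD i false || decide (i ∈ l)

/-- One step of the descending closure pass: a marked index marks its members. [folklore] -/
def closeStep (n : ℕ) (T : List (List ℕ)) (m : List Bool) (i : ℕ) : List Bool :=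
  if m.getD i false then markAll m (elems n T i) else m

/-- The descending closure pass over the indices `|T| - 1, …, 0`. [folklore] -/
def closeMask (n : ℕ) (T : List (List ℕ)) (m : List Bool) : List Bool :=
  (List.range T.length).reverse.foldl (closeStep n T) m

/-- **The mask of active indices**: critical marks, closed downwards. [Blass–Gurevich–Shelah
1999, §5.1] [folklore] -/
def activeMask (n : ℕ) (T : List (List ℕ)) (srep : List CUpdate) : List Bool :=
  closeMask n T (critMask n T srep)

/-- Pointwise disjunction of two masks, over the index range `[0, N)`. [folklore] -/
def orMask (N : ℕ) (a b : List Bool) : List Bool :=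
  (List.range N).map fun i => a.getD i false || b.getD i false

/-- The number of marked indices. [folklore] -/
def countTrue (m : List Bool) : ℕ :=
  ((List.range m.length).filter fun i => m.getD i false).length

/-- Reading a mapped range. [folklore] -/
theorem getD_map_range (f : ℕ → Bool) (N i : ℕ) :
    ((List.range N).map f).getD i false = (decide (i < N) && f i) := by
  rw [List.getD_eq_getElem?_getD, List.getElem?_map]
  by_cases h : i < N
  · rw [List.getElem?_range h]; simp [h]
  · rw [List.getElem?_eq_none (by simpa using h)]; simp [h]

/-- The critical mask marks exactly the valid critical indices. [folklore] -/
theorem getD_critMask (n : ℕ) (T : List (List ℕ)) (srep : List CUpdate) (i : ℕ) :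
    (critMask n T srep).getD i false = true ↔ i < T.length ∧ CritIdx n srep i := by
  rw [critMask, getD_map_range]
  simp only [Bool.and_eq_true, decide_eq_true_eq, Bool.or_eq_true, List.any_eq_true, beq_iff_eq,
    CritIdx]
  constructor
  · rintro ⟨hi, h | ⟨e, he, h | ⟨k, hk, rfl⟩⟩⟩
    · exact ⟨hi, Or.inl h⟩
    · exact ⟨hi, Or.inr ⟨e, he, Or.inl h⟩⟩
    · exact ⟨hi, Or.inr ⟨e, he, Or.inr hk⟩⟩
  · rintro ⟨hi, h | ⟨e, he, h | h⟩⟩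
    · exact ⟨hi, Or.inl h⟩
    · exact ⟨hi, Or.inr ⟨e, he, Or.inl h⟩⟩
    · exact ⟨hi, Or.inr ⟨e, he, Or.inr ⟨i, h, rfl⟩⟩⟩

/-- The critical mask has length `|T|`. [folklore] -/
@[simp] theorem length_critMask (n : ℕ) (T : List (List ℕ)) (srep : List CUpdate) :
    (critMask n T srep).length = T.length := by
  simp [critMask]

/-- Marking keeps the length. [folklore] -/
@[simp] theorem length_markAll (m : List Bool) (l : List ℕ) : (markAll m l).length = m.length := by
  simp [markAll]

/-- Reading a marked mask. [folklore] -/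
theorem getD_markAll (m : List Bool) (l : List ℕ) (i : ℕ) :
    (markAll m l).getD i false = (m.getD i false || decide (i ∈ l ∧ i < m.length)) := by
  rw [markAll, getD_map_range]
  by_cases hi : i < m.length
  · simp [hi]
  · rw [List.getD_eq_default _ _ (Nat.le_of_not_lt hi)]
    simp [hi]

/-- One closure step keeps the length. [folklore] -/
@[simp] theorem length_closeStep (n : ℕ) (T : List (List ℕ)) (m : List Bool) (i : ℕ) :
    (closeStep n T m i).length = m.length := by
  unfold closeStep; split <;> simp

/-- Reading a mask after one closure step. [folklore] -/
theorem getD_closeStep (n : ℕ) (T : List (List ℕ)) (m : List Bool) (i j : ℕ) :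
    (closeStep n T m i).getD j false =
      (m.getD j false || (m.getD i false && decide (j ∈ elems n T i ∧ j < m.length))) := by
  unfold closeStep
  split <;> rename_i h
  · rw [getD_markAll, h, Bool.true_and]
  · simp only [Bool.not_eq_true] at h
    rw [h, Bool.false_and, Bool.or_false]

/-- Invariant of the descending pass after the indices `≥ j` have been processed: length kept,
old marks kept, every mark reachable from an old mark, and every processed marked index has all
its members marked. [folklore] -/
structure CloseInv (n : ℕ) (T : List (List ℕ)) (m₀ m : List Bool) (j : ℕ) : Prop where
  /-- the length is unchanged -/
  length_eq : m.length = m₀.length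
  /-- old marks are kept -/
  mono : ∀ i, m₀.getD i false = true → m.getD i false = true
  /-- new marks are reachable from old marks -/
  reach : ∀ i, m.getD i false = true → ∃ c, m₀.getD c false = true ∧ Reach n T c i
  /-- processed marked indices have marked members -/
  closed : ∀ i, j ≤ i → m.getD i false = true → ∀ k ∈ elems n T i, m.getD k false = true

/-- Processing the next index down keeps the invariant. [folklore] -/
theorem closeInv_closeStep {T : List (List ℕ)} (hT : Canon n T) {m₀ m : List Bool} {j : ℕ}
    (hm₀ : m₀.length = T.length) (h : CloseInv n T m₀ m (j + 1)) (hj : j < T.length) :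
    CloseInv n T m₀ (closeStep n T m j) j := by
  refine ⟨by rw [length_closeStep, h.length_eq], fun i hi => ?_, fun i hi => ?_, fun i hji hi k hk => ?_⟩
  · rw [getD_closeStep, h.mono i hi, Bool.true_or]
  · rw [getD_closeStep, Bool.or_eq_true, Bool.and_eq_true, decide_eq_true_eq] at hi
    rcases hi with hi | ⟨hj', hij, -⟩
    · exact h.reach i hi
    · obtain ⟨c, hc, hr⟩ := h.reach j hj'
      exact ⟨c, hc, hr.tail hij⟩
  · rw [getD_closeStep, Bool.or_eq_true, Bool.and_eq_true, decide_eq_true_eq] at hi ⊢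
    rcases hi with hi | ⟨hj', hij, -⟩
    · rcases Nat.eq_or_lt_of_le hji with rfl | hlt
      · refine Or.inr ⟨hi, hk, ?_⟩
        rw [h.length_eq, hm₀]
        exact (hT.lt_of_mem_elems hj hk).trans hj
      · exact Or.inl (h.closed i hlt hi k hk)
    · -- a member of `j` is below `j`, never among the processed indices `> j`... unless it is:
      -- but then it was marked now, and its own members are handled by `closed` only if `> j`;
      -- members of `j` are `< j`, so `i ∈ elems j` forces `i < j ≤ i`: impossible.
      exact absurd ((hT.lt_of_mem_elems hj hij).trans_le hji) (lt_irrefl i)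

/-- The whole descending pass: from the trivial invariant at `|T|` to the full one at `0`.
[folklore] -/
theorem closeInv_closeMask {T : List (List ℕ)} (hT : Canon n T) {m₀ : List Bool}
    (hm₀ : m₀.length = T.length) : CloseInv n T m₀ (closeMask n T m₀) 0 := by
  have key : ∀ d j, T.length - j = d → j ≤ T.length →
      CloseInv n T m₀ (((List.range T.length).drop j).reverse.foldl (closeStep n T) m₀) j := by
    intro d
    induction d with
    | zero =>
      intro j h hj
      obtain rfl : j = T.length := by omega
      rw [List.drop_of_length_le (by simp)]
      simp only [List.reverse_nil, List.foldl_nil]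
      exact ⟨rfl, fun _ h => h, fun i hi => ⟨i, hi, Reach.refl i⟩, fun i hji hi => by
        rw [List.getD_eq_default _ _ (by rw [hm₀]; exact hji)] at hi
        exact absurd hi (by decide)⟩
    | succ d ih =>
      intro j h hj
      have hjT : j < T.length := by omega
      have hdrop : (List.range T.length).drop j = j :: (List.range T.length).drop (j + 1) := by
        rw [List.drop_eq_getElem_cons (by simpa using hjT), List.getElem_range]
      rw [hdrop, List.reverse_cons, List.foldl_append, List.foldl_cons, List.foldl_nil]
      exact closeInv_closeStep hT hm₀ (ih (j + 1) (by omega) (by omega)) hjT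
  simpa [closeMask] using key _ 0 rfl (Nat.zero_le _)

/-- **The active mask marks exactly the indices reachable from critical indices.** [folklore] -/
theorem getD_activeMask_iff {T : List (List ℕ)} (hT : Canon n T) (srep : List CUpdate) (i : ℕ) :
    (activeMask n T srep).getD i false = true ↔
      i < T.length ∧ ∃ c < T.length, CritIdx n srep c ∧ Reach n T c i := by
  have hinv := closeInv_closeMask hT (m₀ := critMask n T srep) (length_critMask n T srep)
  unfold activeMask
  constructor
  · intro h
    have hi : i < T.length := by
      by_contra hi
      rw [List.getD_eq_default _ _ (by rw [hinv.length_eq, length_critMask]; omega)] at h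
      exact Bool.false_ne_true h
    obtain ⟨c, hc, hr⟩ := hinv.reach i h
    obtain ⟨hcT, hcrit⟩ := (getD_critMask n T srep c).mp hc
    exact ⟨hi, c, hcT, hcrit, hr⟩
  · rintro ⟨-, c, hcT, hcrit, hr⟩
    -- descend along the path from `c`, using closedness at every step
    induction hr with
    | refl => exact hinv.mono _ ((getD_critMask n T srep _).mpr ⟨hcT, hcrit⟩)
    | tail _ hk ih => exact hinv.closed _ (Nat.zero_le _) ih _ hk

/-- The active mask has length `|T|`. [folklore] -/
theorem length_activeMask {T : List (List ℕ)} (hT : Canon n T) (srep : List CUpdate) :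
    (activeMask n T srep).length = T.length := by
  rw [activeMask, (closeInv_closeMask hT (length_critMask n T srep)).length_eq, length_critMask]

/-- **The active mask marks exactly the indices of the ACTIVE objects** of the represented
state. [Blass–Gurevich–Shelah 1999, §5.1] [folklore] -/
theorem getD_activeMask_iff_active {T : List (List ℕ)} {srep : List CUpdate} {Sd : DynState n}
    (hT : Canon n T) (hs : SRel n T srep Sd) (i : ℕ) :
    (activeMask n T srep).getD i false = true ↔ i < T.length ∧ Sd.Active (val n T i) := by
  rw [getD_activeMask_iff hT, active_iff hT hs]
  constructor
  · rintro ⟨hi, hc⟩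
    exact ⟨hi, i, hi, hc, rfl⟩
  · rintro ⟨hi, i', hi', hc, heq⟩
    obtain rfl : i' = i := hT.inj i' i hi' hi heq
    exact ⟨hi, hc⟩

/-- Every active object of the represented state is the object of a marked index. [folklore] -/
theorem exists_idx_of_active {T : List (List ℕ)} {srep : List CUpdate} {Sd : DynState n}
    (hT : Canon n T) (hs : SRel n T srep Sd) {x : HF (Fin n)} (hx : Sd.Active x) :
    ∃ i, (activeMask n T srep).getD i false = true ∧ val n T i = x := by
  obtain ⟨i, hi, hc, rfl⟩ := (active_iff hT hs x).mp hx
  exact ⟨i, (getD_activeMask_iff hT srep i).mpr ⟨hi, hc⟩, rfl⟩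

/-! ### Masks as sets of objects, counting -/

/-- The mask `m` REPRESENTS the set `A` of objects over `T`: `A` is the set of objects of the
marked (valid) indices. [folklore] -/
structure MaskRep (n : ℕ) (T : List (List ℕ)) (m : List Bool) (A : Set (HF (Fin n))) : Prop where
  /-- marked indices are valid -/
  lt : ∀ i, m.getD i false = true → i < T.length
  /-- the represented set -/
  mem_iff : ∀ x, x ∈ A ↔ ∃ i, m.getD i false = true ∧ val n T i = x

/-- The empty mask represents `∅`. [folklore] -/
theorem maskRep_nil (n : ℕ) (T : List (List ℕ)) : MaskRep n T [] (∅ : Set (HF (Fin n))) :=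
  ⟨fun i h => by simp at h, fun _ => by simp⟩

/-- **The active mask represents the set of active objects.** [Blass–Gurevich–Shelah 1999, §5.1]
[folklore] -/
theorem maskRep_activeMask {T : List (List ℕ)} {srep : List CUpdate} {Sd : DynState n}
    (hT : Canon n T) (hs : SRel n T srep Sd) : MaskRep n T (activeMask n T srep) {x | Sd.Active x} :=
  ⟨fun i h => ((getD_activeMask_iff_active hT hs i).mp h).1, fun _ =>
    ⟨fun hx => exists_idx_of_active hT hs hx, fun ⟨i, hi, hix⟩ =>
      hix ▸ ((getD_activeMask_iff_active hT hs i).mp hi).2⟩⟩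

/-- Reading a disjunction of masks. [folklore] -/
theorem getD_orMask (N : ℕ) (a b : List Bool) (i : ℕ) :
    (orMask N a b).getD i false = (decide (i < N) && (a.getD i false || b.getD i false)) :=
  getD_map_range _ N i

/-- Disjunction of masks represents union. [folklore] -/
theorem MaskRep.orMask {T : List (List ℕ)} {a b : List Bool} {A B : Set (HF (Fin n))}
    (ha : MaskRep n T a A) (hb : MaskRep n T b B) : MaskRep n T (Sim.orMask T.length a b) (A ∪ B) := by
  refine ⟨fun i h => ?_, fun x => ?_⟩
  · rw [getD_orMask, Bool.and_eq_true, decide_eq_true_eq] at h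
    exact h.1
  · simp only [Set.mem_union, ha.mem_iff, hb.mem_iff, getD_orMask, Bool.and_eq_true,
      decide_eq_true_eq, Bool.or_eq_true]
    constructor
    · rintro (⟨i, hi, rfl⟩ | ⟨i, hi, rfl⟩)
      · exact ⟨i, ⟨ha.lt i hi, Or.inl hi⟩, rfl⟩
      · exact ⟨i, ⟨hb.lt i hi, Or.inr hi⟩, rfl⟩
    · rintro ⟨i, ⟨-, hi | hi⟩, rfl⟩
      · exact Or.inl ⟨i, hi, rfl⟩
      · exact Or.inr ⟨i, hi, rfl⟩

/-- Representation survives table extensions. [folklore] -/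
theorem MaskRep.of_extends {T T' : List (List ℕ)} {m : List Bool} {A : Set (HF (Fin n))}
    (h : MaskRep n T m A) (hx : Extends n T T') : MaskRep n T' m A :=
  ⟨fun i hi => (h.lt i hi).trans_le hx.length_le, fun x => by
    rw [h.mem_iff]
    exact exists_congr fun i => and_congr_right fun hi => by rw [hx.val_eq (h.lt i hi)]⟩

/-- A marked index is within the mask. [folklore] -/
theorem lt_length_of_getD {m : List Bool} {i : ℕ} (h : m.getD i false = true) : i < m.length := by
  by_contra hi
  rw [List.getD_eq_default _ _ (Nat.le_of_not_lt hi)] at h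
  exact Bool.false_ne_true h

/-- **Counting the marks counts the represented set** (in a canonical table, by injectivity of
`val`). [folklore] -/
theorem MaskRep.encard_eq {T : List (List ℕ)} {m : List Bool} {A : Set (HF (Fin n))} (hT : Canon n T)
    (h : MaskRep n T m A) : A.encard = countTrue m := by
  classical
  set I := (List.range m.length).filter fun i => m.getD i false with hI
  have hInd : I.Nodup := (List.nodup_range).filter _
  have hmemI : ∀ i, i ∈ I ↔ m.getD i false = true := fun i => by
    rw [hI, List.mem_filter, List.mem_range]
    exact ⟨fun h => h.2, fun h => ⟨lt_length_of_getD h, h⟩⟩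
  have hA : A = ↑(I.toFinset.image (val n T)) := by
    ext x
    rw [h.mem_iff, Finset.coe_image, Set.mem_image]
    simp only [Finset.mem_coe, List.mem_toFinset, hmemI]
  rw [hA, Set.encard_coe_eq_coe_finsetCard, Finset.card_image_of_injOn, List.toFinset_card_of_nodup hInd]
  · rfl
  · intro i hi j hj hij
    simp only [Finset.mem_coe, List.mem_toFinset, hmemI] at hi hj
    exact hT.inj i j (h.lt i hi) (h.lt j hj) hij

/-! ### Rounds and the run -/

/-- The state of the simulation between rounds: table-with-flag, coded state, accumulated
active mask, status. [folklore] -/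
abbrev RS : Type := TS × (List CUpdate × (List Bool × ℕ))

/-- Length of the code of a mask (a bit string codes itself). [folklore] -/
def cBL (l : List Bool) : ℕ := l.length

/-- Measure of the round state. [folklore] -/
def μR (st : RS) : ℕ := cP (cTS st.1) (cP (cUL st.2.1) (cP (cBL st.2.2.1) (cN st.2.2.2)))

/-- The status of a halted state read off the index of `Output`: `1` (`true`), `2` (`false`),
`4` (not Boolean). [Blass–Gurevich–Shelah 1999, §5.1 (accepts / rejects)] [folklore] -/
def statusOf (n o : ℕ) : ℕ := if isTrueIdx n o then 1 else if o == n then 2 else 4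

/-- **One round of the simulation** at the state `A_k`: idle unless running (status `0`);
accumulate the census of `A_k` and abort (status `3`) if it exceeds `qn = q(n)`; if `Halt` holds
report the output (`statusOf`); otherwise fire the program's rule once.
[Blass–Gurevich–Shelah 1999, §5.1–5.2] [folklore] -/
def round (R : Rule) (B n : ℕ) (adj : List Bool) (qn : ℕ) (st : RS) : RS :=
  if !(st.2.2.2 == 0) then st
  else
    let act := orMask st.1.1.length st.2.2.1 (activeMask n st.1.1 st.2.1)
    if decide (qn < countTrue act) then (st.1, (st.2.1, (act, 3)))
    else if isTrueIdx n (lookupS n st.2.1 haltSym []) then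
      (st.1, (st.2.1, (act, statusOf n (lookupS n st.2.1 outputSym []))))
    else
      let rd := den ⟨B, n, adj, st.2.1⟩ R [] st.1
      (rd.1, (fireS n st.2.1 rd.2, (act, 0)))

/-- The initial round state: initial table, empty coded state (all locations `∅`), empty mask,
running. [Blass–Gurevich–Shelah 1999, §4.3 (initial state)] [folklore] -/
def initRS (n : ℕ) : RS := ((initTab n, false), ([], ([], 0)))

/-- **The guarded run**: `pn + 1` rounds (`pn = p(n)`) from the initial state.
[Blass–Gurevich–Shelah 1999, §5.1 (the run of a PTime program)] [folklore] -/
def run (R : Rule) (B n : ℕ) (adj : List Bool) (qn pn : ℕ) : RS :=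
  foldCap μR B (fun (_ : Unit) st => round R B n adj qn st) (initRS n) (List.replicate (pn + 1) ())

/-- The run of a PTime bounded program `(Π, p, q)` with budget `B` on the graph coded by
`(n, adj)`. [Blass–Gurevich–Shelah 1999, §5.1] [folklore] -/
def runP (P : CPTCardProgram) (B n : ℕ) (adj : List Bool) : RS :=
  run P.prog.rule B n adj (P.activeBound.eval n) (P.stepBound.eval n)

/-! ### The abstract bounded run -/

section Abstract

variable (Pr : Program) (G : SimpleGraph (Fin n)) (qn : ℕ)

/-- The EVENT at stage `j` of the run: `3` if the objects active up to stage `j` exceed `qn`,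
else, if `Halt` holds at `A_j`, the status of the output (`1` true, `2` false, `4` neither),
else `0` (the run goes on). [Blass–Gurevich–Shelah 1999, §5.1] [folklore] -/
def absStatus (j : ℕ) : ℕ := by
  classical
  exact if (qn : ℕ∞) < (Pr.activeSet G j).encard then 3
    else if (Pr.stateAt G j).halt = HF.ofBool true then
      (if (Pr.stateAt G j).output = HF.ofBool true then 1
        else if (Pr.stateAt G j).output = HF.ofBool false then 2 else 4)
    else 0

/-- The status after `k` rounds: the first nonzero event among stages `< k`, else `0`.
[Blass–Gurevich–Shelah 1999, §5.1 (the run of a PTime program is the longest initial segment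
within the bounds)] [folklore] -/
def absRun : ℕ → ℕ
  | 0 => 0
  | k + 1 => if absRun k = 0 then absStatus Pr G qn k else absRun k

variable {Pr G qn}

/-- A zero status means no event so far. [folklore] -/
theorem absRun_eq_zero_iff {k : ℕ} : absRun Pr G qn k = 0 ↔ ∀ j < k, absStatus Pr G qn j = 0 := by
  induction k with
  | zero => simp [absRun]
  | succ k ih =>
    rw [absRun]
    split <;> rename_i h
    · rw [ih] at h
      constructor
      · intro hk j hj
        rcases Nat.lt_succ_iff_lt_or_eq.mp hj with hj | rfl
        · exact h j hj
        · exact hk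
      · intro hall
        exact hall k k.lt_succ_self
    · constructor
      · intro h0; exact absurd h0 h
      · intro hall
        exact absurd (ih.mpr fun j hj => hall j (Nat.lt_succ_of_lt hj)) h

/-- The first event determines the status. [folklore] -/
theorem absRun_eq_of_first {j k : ℕ} (hjk : j < k) (hbefore : ∀ i < j, absStatus Pr G qn i = 0)
    (hj : absStatus Pr G qn j ≠ 0) : absRun Pr G qn k = absStatus Pr G qn j := by
  induction k with
  | zero => exact absurd hjk (Nat.not_lt_zero _)
  | succ k ih =>
    rw [absRun]
    rcases Nat.lt_succ_iff_lt_or_eq.mp hjk with hjk | rfl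
    · have := ih hjk
      rw [if_neg (by rw [this]; exact hj), this]
    · rw [if_pos (absRun_eq_zero_iff.mpr hbefore)]

/-- A nonzero status comes from a first event. [folklore] -/
theorem exists_first_of_absRun_ne_zero {k : ℕ} (h : absRun Pr G qn k ≠ 0) :
    ∃ j < k, (∀ i < j, absStatus Pr G qn i = 0) ∧ absRun Pr G qn k = absStatus Pr G qn j := by
  induction k with
  | zero => exact absurd rfl h
  | succ k ih =>
    rw [absRun] at h ⊢
    split <;> rename_i h0
    · exact ⟨k, k.lt_succ_self, absRun_eq_zero_iff.mp h0, rfl⟩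
    · obtain ⟨j, hj, hb, he⟩ := ih h0
      exact ⟨j, Nat.lt_succ_of_lt hj, hb, he⟩

/-- The active sets of a run increase with the stage. [folklore] -/
theorem activeSet_mono {i l : ℕ} (h : i ≤ l) : Pr.activeSet G i ⊆ Pr.activeSet G l :=
  fun _ ⟨j, hj, hx⟩ => ⟨j, hj.trans h, hx⟩

/-- Unfolding the event `1`. [folklore] -/
theorem absStatus_eq_one_iff {j : ℕ} : absStatus Pr G qn j = 1 ↔
    (Pr.activeSet G j).encard ≤ qn ∧ (Pr.stateAt G j).halt = HF.ofBool true ∧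
      (Pr.stateAt G j).output = HF.ofBool true := by
  unfold absStatus
  split_ifs with h1 h2 h3 h4
  · exact iff_of_false (by decide) fun h => absurd h.1 (not_le.mpr h1)
  · exact iff_of_true rfl ⟨not_lt.mp h1, h2, h3⟩
  · exact iff_of_false (by decide) fun h => h3 h.2.2
  · exact iff_of_false (by decide) fun h => h3 h.2.2
  · exact iff_of_false (by decide) fun h => h2 h.2.1

/-- Unfolding the event `2`. [folklore] -/
theorem absStatus_eq_two_iff {j : ℕ} : absStatus Pr G qn j = 2 ↔
    (Pr.activeSet G j).encard ≤ qn ∧ (Pr.stateAt G j).halt = HF.ofBool true ∧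
      (Pr.stateAt G j).output = HF.ofBool false := by
  unfold absStatus
  have h10 : (HF.ofBool true : HF (Fin n)) ≠ HF.ofBool false := by simp
  split_ifs with h1 h2 h3 h4
  · exact iff_of_false (by decide) fun h => absurd h.1 (not_le.mpr h1)
  · exact iff_of_false (by decide) fun h => h10 (h3.symm.trans h.2.2)
  · exact iff_of_true rfl ⟨not_lt.mp h1, h2, h4⟩
  · exact iff_of_false (by decide) fun h => h4 h.2.2
  · exact iff_of_false (by decide) fun h => h2 h.2.1

/-- Unfolding the event `0`. [folklore] -/
theorem absStatus_eq_zero_iff {j : ℕ} : absStatus Pr G qn j = 0 ↔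
    (Pr.activeSet G j).encard ≤ qn ∧ (Pr.stateAt G j).halt ≠ HF.ofBool true := by
  unfold absStatus
  split_ifs with h1 h2 h3 h4
  · exact iff_of_false (by decide) fun h => absurd h.1 (not_le.mpr h1)
  · exact iff_of_false (by decide) fun h => h.2 h2
  · exact iff_of_false (by decide) fun h => h.2 h2
  · exact iff_of_false (by decide) fun h => h.2 h2
  · exact iff_of_true rfl ⟨not_lt.mp h1, h2⟩

/-- **The abstract run decides acceptance**: `p(n) + 1` rounds end in status `1` iff the bounded
program accepts. [Blass–Gurevich–Shelah 1999, §5.1] [folklore] -/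
theorem absRun_eq_one_iff (P : CPTCardProgram) (G : SimpleGraph (Fin n)) :
    absRun P.prog G (P.activeBound.eval n) (P.stepBound.eval n + 1) = 1 ↔ P.Accepts ⟨n, G⟩ := by
  constructor
  · intro h
    obtain ⟨j, hj, hb, he⟩ := exists_first_of_absRun_ne_zero (by rw [h]; decide)
    rw [h] at he
    obtain ⟨hc, hh, ho⟩ := absStatus_eq_one_iff.mp he.symm
    refine ⟨j, Nat.lt_succ_iff.mp hj, ⟨fun i hi => (absStatus_eq_zero_iff.mp (hb i hi)).2, hh⟩, hc, ho⟩
  · rintro ⟨l, hl, ⟨hbefore, hh⟩, hc, ho⟩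
    have hfirst : ∀ i < l, absStatus P.prog G (P.activeBound.eval n) i = 0 := fun i hi =>
      absStatus_eq_zero_iff.mpr ⟨(Set.encard_le_encard (activeSet_mono hi.le)).trans hc, hbefore i hi⟩
    have h1 : absStatus P.prog G (P.activeBound.eval n) l = 1 := absStatus_eq_one_iff.mpr ⟨hc, hh, ho⟩
    rw [absRun_eq_of_first (Nat.lt_succ_of_le hl) hfirst (by rw [h1]; decide), h1]

/-- The abstract run decides rejection: status `2` iff the bounded program rejects.
[Blass–Gurevich–Shelah 1999, §5.1] [folklore] -/
theorem absRun_eq_two_iff (P : CPTCardProgram) (G : SimpleGraph (Fin n)) :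
    absRun P.prog G (P.activeBound.eval n) (P.stepBound.eval n + 1) = 2 ↔ P.Rejects ⟨n, G⟩ := by
  constructor
  · intro h
    obtain ⟨j, hj, hb, he⟩ := exists_first_of_absRun_ne_zero (by rw [h]; decide)
    rw [h] at he
    obtain ⟨hc, hh, ho⟩ := absStatus_eq_two_iff.mp he.symm
    refine ⟨j, Nat.lt_succ_iff.mp hj, ⟨fun i hi => (absStatus_eq_zero_iff.mp (hb i hi)).2, hh⟩, hc, ho⟩
  · rintro ⟨l, hl, ⟨hbefore, hh⟩, hc, ho⟩
    have hfirst : ∀ i < l, absStatus P.prog G (P.activeBound.eval n) i = 0 := fun i hi =>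
      absStatus_eq_zero_iff.mpr ⟨(Set.encard_le_encard (activeSet_mono hi.le)).trans hc, hbefore i hi⟩
    have h2 : absStatus P.prog G (P.activeBound.eval n) l = 2 := absStatus_eq_two_iff.mpr ⟨hc, hh, ho⟩
    rw [absRun_eq_of_first (Nat.lt_succ_of_le hl) hfirst (by rw [h2]; decide), h2]

end Abstract

/-! ### Soundness of a round -/

/-- The objects active before stage `k`. [folklore] -/
def prevActive (Pr : Program) (G : SimpleGraph (Fin n)) (k : ℕ) : Set (HF (Fin n)) :=
  {x | ∃ i < k, (Pr.stateAt G i).Active x}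

/-- No object is active before stage `0`. [folklore] -/
theorem prevActive_zero (Pr : Program) (G : SimpleGraph (Fin n)) : prevActive Pr G 0 = ∅ := by
  ext x; simp [prevActive]

/-- The objects active before stage `k + 1` are those of `activeSet k`. [folklore] -/
theorem prevActive_succ (Pr : Program) (G : SimpleGraph (Fin n)) (k : ℕ) :
    prevActive Pr G (k + 1) = Pr.activeSet G k := by
  ext x; simp [prevActive, Program.activeSet]

/-- Accumulating the census of stage `k`. [folklore] -/
theorem prevActive_union (Pr : Program) (G : SimpleGraph (Fin n)) (k : ℕ) :
    prevActive Pr G k ∪ {x | (Pr.stateAt G k).Active x} = Pr.activeSet G k := by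
  ext x
  simp only [prevActive, Program.activeSet, Set.mem_union, Set.mem_setOf_eq]
  constructor
  · rintro (⟨i, hi, h⟩ | h)
    · exact ⟨i, hi.le, h⟩
    · exact ⟨k, le_rfl, h⟩
  · rintro ⟨i, hi, h⟩
    rcases hi.lt_or_eq with hi | rfl
    · exact Or.inl ⟨i, hi, h⟩
    · exact Or.inr h

section RoundSound

/-- **The simulation invariant between rounds**: after `k` rounds still running, the table is
canonical with its flag down, the coded state represents `A_k`, and the accumulated mask
represents the objects active before stage `k`. [folklore] -/
structure RInv (Pr : Program) (n : ℕ) (adj : List Bool) (k : ℕ) (st : RS) : Prop where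
  /-- the overflow flag is down -/
  flag : st.1.2 = false
  /-- the table is canonical -/
  canon : Canon n st.1.1
  /-- the coded state represents `A_k` -/
  srel : SRel n st.1.1 st.2.1 (Pr.stateAt (TwoColouring.graph n adj) k)
  /-- the mask represents the objects active before stage `k` -/
  mask : MaskRep n st.1.1 st.2.2.1 (prevActive Pr (TwoColouring.graph n adj) k)
  /-- still running -/
  status : st.2.2.2 = 0

/-- The initial round state satisfies the invariant at stage `0`. [folklore] -/
theorem rInv_initRS (Pr : Program) (n : ℕ) (adj : List Bool) : RInv Pr n adj 0 (initRS n) := by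
  refine ⟨rfl, canon_initTab n, ⟨fun e he => ?_, fun e he => ?_, fun e he => ?_, fun e he => ?_,
    fun f args h => ?_⟩, ?_, rfl⟩
  · simp [initRS] at he
  · simp [initRS] at he
  · simp [initRS] at he
  · simp [initRS] at he
  · exact absurd rfl h
  · rw [prevActive_zero]
    exact maskRep_nil n _

/-- Reading `Halt` and `Output` off the coded state. [folklore] -/
theorem val_lookupS_nil {T : List (List ℕ)} {srep : List CUpdate} {Sd : DynState n} (hT : Canon n T)
    (hs : SRel n T srep Sd) (f : ℕ) :
    val n T (lookupS n srep f []) = Sd f [] ∧ lookupS n srep f [] < T.length := by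
  simpa using hs.val_lookupS hT f (idxs := []) (by simp)

/-- `statusOf` reads the abstract output status. [folklore] -/
theorem statusOf_eq {T : List (List ℕ)} {srep : List CUpdate} {Sd : DynState n} (hT : Canon n T)
    (hs : SRel n T srep Sd) :
    statusOf n (lookupS n srep outputSym []) =
      (by classical exact if Sd.output = HF.ofBool true then 1
        else if Sd.output = HF.ofBool false then 2 else 4) := by
  classical
  obtain ⟨hval, hlt⟩ := val_lookupS_nil hT hs outputSym
  have h1 : isTrueIdx n (lookupS n srep outputSym []) = true ↔ Sd.output = HF.ofBool true := by
    rw [isTrueIdx_iff hT hlt, hval]; rfl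
  have h2 : (lookupS n srep outputSym [] == n) = true ↔ Sd.output = HF.ofBool false := by
    rw [beq_iff_eq, ← hT.val_eq_empty_iff hlt, hval, HF.ofBool_false]; rfl
  unfold statusOf
  by_cases ht : Sd.output = HF.ofBool true
  · rw [if_pos (h1.mpr ht), if_pos ht]
  · rw [if_neg (fun h => ht (h1.mp h)), if_neg ht]
    by_cases hf : Sd.output = HF.ofBool false
    · rw [if_pos (h2.mpr hf), if_pos hf]
    · rw [if_neg (fun h => hf (h2.mp h)), if_neg hf]

/-- **Soundness of one round.** From the invariant at stage `k`, if the flag is down after the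
round then the new status is the abstract event at stage `k`, and if that event is `0` the
invariant holds at stage `k + 1`. [Blass–Gurevich–Shelah 1999, §5.1–5.2] [folklore] -/
theorem round_sound {Pr : Program} {R : Rule} (hR : Pr.rule = R) {B n : ℕ} {adj : List Bool} {qn k : ℕ}
    {st : RS} (h : RInv Pr n adj k st) (hf : (round R B n adj qn st).1.2 = false) :
    (round R B n adj qn st).2.2.2 = absStatus Pr (TwoColouring.graph n adj) qn k ∧
      (absStatus Pr (TwoColouring.graph n adj) qn k = 0 →
        RInv Pr n adj (k + 1) (round R B n adj qn st)) := by
  classical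
  have hT := h.canon
  have hs := h.srel
  -- the accumulated census
  set act := orMask st.1.1.length st.2.2.1 (activeMask n st.1.1 st.2.1) with hact
  have hrep : MaskRep n st.1.1 act (Pr.activeSet (TwoColouring.graph n adj) k) := by
    rw [← prevActive_union]
    exact h.mask.orMask (maskRep_activeMask hT hs)
  have hcount : (Pr.activeSet (TwoColouring.graph n adj) k).encard = countTrue act := hrep.encard_eq hT
  obtain ⟨hhalt, hhlt⟩ := val_lookupS_nil hT hs haltSym
  have hhalt' : isTrueIdx n (lookupS n st.2.1 haltSym []) = true ↔
      (Pr.stateAt (TwoColouring.graph n adj) k).halt = HF.ofBool true := by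
    rw [isTrueIdx_iff hT hhlt, hhalt]; rfl
  unfold round at hf ⊢
  rw [h.status] at hf ⊢
  simp only [beq_self_eq_true, Bool.not_true, Bool.false_eq_true, ↓reduceIte] at hf ⊢
  rw [← hact] at hf ⊢
  by_cases hbig : qn < countTrue act
  · -- too many active objects
    simp only [hbig, decide_true, ↓reduceIte]
    have h3 : absStatus Pr (TwoColouring.graph n adj) qn k = 3 := by
      unfold absStatus
      rw [if_pos (by rw [hcount]; exact_mod_cast hbig)]
    exact ⟨h3.symm, fun h0 => absurd (h0.symm.trans h3) (by decide)⟩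
  · simp only [hbig, decide_false, Bool.false_eq_true, ↓reduceIte] at hf ⊢
    have hle : ¬ ((qn : ℕ∞) < (Pr.activeSet (TwoColouring.graph n adj) k).encard) := by
      rw [hcount]; exact_mod_cast hbig
    by_cases hh : isTrueIdx n (lookupS n st.2.1 haltSym []) = true
    · -- halted: report the output
      simp only [hh, ↓reduceIte]
      have hstat : absStatus Pr (TwoColouring.graph n adj) qn k =
          statusOf n (lookupS n st.2.1 outputSym []) := by
        rw [statusOf_eq hT hs, absStatus, if_neg hle, if_pos (hhalt'.mp hh)]
      refine ⟨hstat.symm, fun h0 => ?_⟩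
      rw [hstat, statusOf] at h0
      split_ifs at h0
    · -- running: one step of the program
      simp only [hh, Bool.false_eq_true, ↓reduceIte] at hf ⊢
      have h0 : absStatus Pr (TwoColouring.graph n adj) qn k = 0 := by
        rw [absStatus, if_neg hle, if_neg (fun h' => hh (hhalt'.mpr h'))]
      refine ⟨h0.symm, fun _ => ?_⟩
      -- the step
      set C : Ctx := ⟨B, n, adj, st.2.1⟩ with hC
      have hI : TInv C (Pr.stateAt (TwoColouring.graph n adj) k) st.1.1 := ⟨hT, hs⟩
      obtain ⟨hx, hv, hiff⟩ := den_sound C (Pr.stateAt (TwoColouring.graph n adj) k) R [] st.1 hf hI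
        (fun p hp => by simp at hp)
      rw [envOf_nil hT] at hiff
      have hstep : Pr.stateAt (TwoColouring.graph n adj) (k + 1) =
          fire (Pr.stateAt (TwoColouring.graph n adj) k)
            (R.den (TwoColouring.graph n adj) (Pr.stateAt (TwoColouring.graph n adj) k) fun _ => ∅) := by
        rw [Program.stateAt_succ, Program.step, hR]
      refine ⟨hf, hx.canon, ?_, ?_, rfl⟩
      · rw [hstep]
        exact srel_fireS hx.canon (hx.srel hs) hv hiff
      · show MaskRep n (den C R [] st.1).1.1 act (prevActive Pr (TwoColouring.graph n adj) (k + 1))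
        rw [prevActive_succ]
        exact hrep.of_extends hx

end RoundSound

/-! ### Soundness of the run -/

/-- The guarded fold read from the back. [folklore] -/
theorem foldCap_append_singleton {α γ : Type} (μ : TS × γ → ℕ) (B : ℕ) (step : α → TS × γ → TS × γ)
    (init : TS × γ) (l : List α) (a : α) :
    foldCap μ B step init (l ++ [a]) =
      (if (foldCap μ B step init l).1.2 || decide (B < μ (foldCap μ B step init l)) then
        (((foldCap μ B step init l).1.1, true), (foldCap μ B step init l).2)
      else step a (foldCap μ B step init l)) := by
  unfold foldCap
  rw [List.foldl_append, List.foldl_cons, List.foldl_nil]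

/-- Reading the last round backwards: if the flag is down at the end, it was down before, the
guard was silent and the last round ran. [folklore] -/
theorem foldCap_append_singleton_of_flag {α γ : Type} (μ : TS × γ → ℕ) (B : ℕ)
    (step : α → TS × γ → TS × γ) {init : TS × γ} {l : List α} {a : α}
    (h : (foldCap μ B step init (l ++ [a])).1.2 = false) :
    (foldCap μ B step init l).1.2 = false ∧
      foldCap μ B step init (l ++ [a]) = step a (foldCap μ B step init l) := by
  rw [foldCap_append_singleton] at h ⊢
  by_cases hg : ((foldCap μ B step init l).1.2 || decide (B < μ (foldCap μ B step init l))) = true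
  · rw [if_pos hg] at h
    simp at h
  · simp only [Bool.or_eq_true, decide_eq_true_eq, not_or, Bool.not_eq_true] at hg
    rw [if_neg (by simp [hg.1, hg.2])]
    exact ⟨hg.1, rfl⟩

/-- **The run simulates the abstract run**: after `j` rounds with the flag down, the status is
`absRun j`, and while it is `0` the simulation invariant holds at stage `j`. [folklore] -/
theorem run_sim (Pr : Program) (B : ℕ) (n : ℕ) (adj : List Bool) (qn : ℕ) (j : ℕ)
    (hf : (foldCap μR B (fun (_ : Unit) st => round Pr.rule B n adj qn st) (initRS n)
      (List.replicate j ())).1.2 = false) :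
    (foldCap μR B (fun (_ : Unit) st => round Pr.rule B n adj qn st) (initRS n)
        (List.replicate j ())).2.2.2 = absRun Pr (TwoColouring.graph n adj) qn j ∧
      (absRun Pr (TwoColouring.graph n adj) qn j = 0 →
        RInv Pr n adj j (foldCap μR B (fun (_ : Unit) st => round Pr.rule B n adj qn st)
          (initRS n) (List.replicate j ()))) := by
  induction j with
  | zero => exact ⟨rfl, fun _ => rInv_initRS Pr n adj⟩
  | succ j ih =>
    rw [List.replicate_succ'] at hf ⊢
    obtain ⟨hf', heq⟩ := foldCap_append_singleton_of_flag μR B _ hf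
    rw [heq] at hf ⊢
    obtain ⟨hstat, hinv⟩ := ih hf'
    set st := foldCap μR B (fun (_ : Unit) st => round Pr.rule B n adj qn st) (initRS n)
      (List.replicate j ())
    rw [absRun]
    by_cases h0 : absRun Pr (TwoColouring.graph n adj) qn j = 0
    · rw [if_pos h0]
      exact round_sound rfl (hinv h0) hf
    · rw [if_neg h0]
      have hidle : round Pr.rule B n adj qn st = st := by
        unfold round
        rw [hstat]
        simp [h0]
      rw [hidle]
      exact ⟨hstat, fun h => absurd h h0⟩

/-- **Soundness of the simulation modulo overflow.** If the overflow flag is down at the end of the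
run of `(Π, p, q)` with budget `B` on `(n, adj)`, then its status is `1` iff the program accepts
the coded graph and `2` iff it rejects it. [Blass–Gurevich–Shelah 1999, §5.2 Theorem 1]
[folklore] -/
theorem runP_sound (P : CPTCardProgram) (B n : ℕ) (adj : List Bool) (hf : (runP P B n adj).1.2 = false) :
    ((runP P B n adj).2.2.2 = 1 ↔ P.Accepts ⟨n, TwoColouring.graph n adj⟩) ∧
      ((runP P B n adj).2.2.2 = 2 ↔ P.Rejects ⟨n, TwoColouring.graph n adj⟩) := by
  obtain ⟨hstat, -⟩ := run_sim P.prog B n adj (P.activeBound.eval n) (P.stepBound.eval n + 1) hf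
  unfold runP run
  rw [hstat, absRun_eq_one_iff, absRun_eq_two_iff]
  exact ⟨Iff.rfl, Iff.rfl⟩

end BGS.Sim

end Literature.ModelTheory.FiniteModelTheory
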